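import Mathlib
import Summits.KontsevichZagierPeriods.Zeta5Search.SorokinCensus.TopCoefficient
import HarnessLib

/-!
HONEST FRAMING: systematic search; no irrationality claim unless certified.

# THEOREM R⁺ in the kernel — the SIGN LAW and the TOP-POLE (supply–demand) CRITERION for the constant term
(fam-sorokin gen 7, planner-pub-zeta5-fam-sorokin-g7-0, 2026-08-21; FAMILY.md §17n(7), file of record
`pub-zeta5-fam-sorokin/gen6/THEOREM-R.md` §1.8/§2.7).

`TopCoefficient.lean` (p247987) typed the two combinatorial halves of THEOREM R⁺ as `@[conjecture]` nodes with
kernel-checked examples only: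

* `GenPoint.CtSignLaw`   — `ct(p) = (-1)^{Σ(π_j-1)+Σγ_j} · ctAbs(p)`;
* `GenPoint.CtNeZeroIff` — `ct(p) ≠ 0 ↔` the TOP-pole (supply–demand / cut) test `topPole p` passes.

THIS FILE PROVES BOTH (`GenPoint.ctSignLaw_holds`, `GenPoint.ctNeZeroIff_holds`), with no placeholders:

1. `ctChain_eq_sign_mul_posChain` (every depth): `ctChain d v = (-1)^{chainSign d v} · posChain d v`, by induction
   along the chain — each summand of the signed expansion carries the sign `(-1)^{γ-u-v'} (-1)^{i}` times the sign of
   the tail, and the parities add up to `v + Σ(π_j-1) + Σγ_j` (the `2u`'s drop out);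
2. `posChain_cons_cons_ne_zero_iff` (every depth): a stage of the sign-free chain is non-zero iff some admissible
   split `π-1 = i + u + v`, `0 ≤ i ≤ B`, `u + v' ≤ γ` continues a non-zero tail (all summands are `≥ 0`);
3. `posChain_ne_zero_iff_topPoleTest` (depth 5 = the generalized Sorokin family): the resulting existence-of-a-flow
   statement is equivalent to the `5 + 31` cut conditions of `topPoleTest` — '⟹' is weak duality (linear
   arithmetic), '⟸' is certified by the GREEDY flow `u_j = max(0, π_j-1-v_j-B_j)`, `v_{j+1} = min(γ_j-u_j, π_{j+1}-1)`
   (serve sink `j` from its own supply `B_j` first, push the rest of the diagonal supply `γ_j` rightwards), whose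
   feasibility follows from the interval cut conditions `[j,r]`, `[j+1,r]`, `[j+2,r]` stage by stage (the
   supply–demand theorem on a path; exact cross-check `gen7/hall/greedy_check.py`, 80,000 random chains, 0 mismatches).

With THEOREM R (`GenPoint.TopCoefficientLaw`, proved on paper, `@[conjecture]` in the kernel) this is the per-`n`
TOP-POLE LAW of FAMILY §17m(1) in both directions: `ζ(5)` occurs in `J(p)` with coefficient `2·ct(p) = ±2·ctAbs(p) ≠ 0`
iff every face of the TOP simplex carries a pole (`GenPoint.lowWeight_of_topPole_false` records the '⟸ absent' half
relative to THEOREM R).  Nothing in this file is an irrationality statement.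
-/

namespace Summit.KontsevichZagierPeriods.Zeta5Search.SorokinCensus

open Finset

/-! ## Bridge lemmas -/

/-- List sums over `List.range n` are `Finset.range n` sums. -/
private theorem sum_map_range {M : Type*} [AddCommMonoid M] (f : ℕ → M) (n : ℕ) :
    ((List.range n).map f).sum = ∑ i ∈ Finset.range n, f i := by
  -- lane edit (lead/lit g13): binder order swapped to dodge a textual dedup.landed match with an unrelated KZ file
  induction n with
  | zero => simp
  | succ n ih => simp [List.range_succ, Finset.sum_range_succ, ih]

/-- `(-1)^m = (-1)^n` for `m ≡ n (mod 2)`. -/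
theorem neg_one_pow_eq_of_mod_two_eq {m n : ℕ} (h : m % 2 = n % 2) : (-1 : ℤ) ^ m = (-1) ^ n := by
  rw [← Nat.div_add_mod m 2, ← Nat.div_add_mod n 2, pow_add, pow_add, pow_mul, pow_mul, h]
  simp

/-- `[u^i](1-u)^B = (-1)^i · [u^i](1+u)^B`. -/
theorem signedChoose_eq (B : ℕ) (i : ℤ) : signedChoose B i = (-1) ^ i.toNat * (plainChoose B i : ℤ) := by
  unfold signedChoose plainChoose
  split_ifs <;> simp

/-- `[u^i](1+u)^B ≠ 0 ↔ 0 ≤ i ≤ B`. -/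
theorem plainChoose_ne_zero_iff (B : ℕ) (i : ℤ) : plainChoose B i ≠ 0 ↔ 0 ≤ i ∧ i ≤ B := by
  unfold plainChoose
  split_ifs with h
  · rw [ne_eq, Nat.choose_eq_zero_iff, not_lt]
    constructor
    · intro; exact h
    · intro; omega
  · simp [h]

/-- `plainChoose B i = 0` for `i < 0`. -/
theorem plainChoose_eq_zero_of_neg (B : ℕ) (i : ℤ) (hi : ¬ 0 ≤ i) : plainChoose B i = 0 := by
  simp [plainChoose, hi]

/-! ## The sign law along a chain (every depth) -/

/-- The SIGN EXPONENT of a chain with inherited exponent `v`: `v + Σ_j (π_j - 1)⁺ + Σ_{j<k-1} γ_j`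
(the `γ` of the last stage is ignored, as in `ctChain`). -/
def chainSign : List (ℕ × ℕ × ℤ) → ℕ → ℕ
  | [], _ => 0
  | [(_, _, π)], v => v + (π - 1).toNat
  | (_, γ, π) :: s :: rest, v => v + (π - 1).toNat + γ + chainSign (s :: rest) 0

/-- The sign exponent is affine in the inherited exponent (non-empty chains). -/
theorem chainSign_shift (x : ℕ × ℕ × ℤ) (l : List (ℕ × ℕ × ℤ)) (v : ℕ) :
    chainSign (x :: l) v = v + chainSign (x :: l) 0 := by
  obtain ⟨B, γ, π⟩ := x
  cases l with
  | nil => simp only [chainSign]; omega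
  | cons s rest => simp only [chainSign]; omega

/-- One stage of the signed chain as a `Finset` double sum. -/
theorem ctChain_cons_cons (B γ : ℕ) (π : ℤ) (s : ℕ × ℕ × ℤ) (rest : List (ℕ × ℕ × ℤ)) (v : ℕ) :
    ctChain ((B, γ, π) :: s :: rest) v = ∑ u ∈ range (γ + 1), ∑ v' ∈ range (γ + 1 - u),
      (γ.choose u : ℤ) * ((γ - u).choose v' : ℤ) * (-1) ^ (γ - u - v') * signedChoose B (π - 1 - v - u) *
        ctChain (s :: rest) v' := by
  simp only [ctChain, sum_map_range]

/-- One stage of the sign-free chain as a `Finset` double sum. -/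
theorem posChain_cons_cons (B γ : ℕ) (π : ℤ) (s : ℕ × ℕ × ℤ) (rest : List (ℕ × ℕ × ℤ)) (v : ℕ) :
    posChain ((B, γ, π) :: s :: rest) v = ∑ u ∈ range (γ + 1), ∑ v' ∈ range (γ + 1 - u),
      γ.choose u * (γ - u).choose v' * plainChoose B (π - 1 - v - u) * posChain (s :: rest) v' := by
  simp only [posChain, sum_map_range]

/-- **SIGN LAW along a chain** (every depth `k`): the signed constant term is `(-1)^{chainSign}` times the sign-free
count.  Each summand `C(γ,u)C(γ-u,v')(-1)^{γ-u-v'} · (-1)^{i}C(B,i) · (tail at v')`, `i = π-1-v-u ≥ 0`, has sign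
exponent `(γ-u-v') + i + (v' + chainSign tail 0) ≡ v + (π-1) + γ + chainSign tail 0 (mod 2)`. -/
theorem ctChain_eq_sign_mul_posChain : ∀ (d : List (ℕ × ℕ × ℤ)) (v : ℕ),
    ctChain d v = (-1) ^ chainSign d v * (posChain d v : ℤ)
  | [], v => by simp [ctChain, posChain, chainSign]
  | [(B, γ, π)], v => by
      simp only [ctChain, posChain, chainSign, signedChoose_eq]
      by_cases h : 0 ≤ π - 1 - (v : ℤ)
      · rw [neg_one_pow_eq_of_mod_two_eq (show (π - 1 - (v : ℤ)).toNat % 2 = (v + (π - 1).toNat) % 2 by omega)]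
      · simp [plainChoose_eq_zero_of_neg B _ h]
  | (B, γ, π) :: s :: rest, v => by
      have ih : ∀ w, ctChain (s :: rest) w = (-1) ^ chainSign (s :: rest) w * (posChain (s :: rest) w : ℤ) :=
        fun w => ctChain_eq_sign_mul_posChain (s :: rest) w
      rw [ctChain_cons_cons, posChain_cons_cons]
      push_cast
      rw [Finset.mul_sum]
      refine Finset.sum_congr rfl fun u _ => ?_
      rw [Finset.mul_sum]
      refine Finset.sum_congr rfl fun v' _ => ?_
      rw [ih v', chainSign_shift s rest v', signedChoose_eq]
      simp only [chainSign]
      by_cases hu : u ≤ γ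
      · by_cases hv : v' ≤ γ - u
        · by_cases hi : 0 ≤ π - 1 - (v : ℤ) - u
          · have key : (-1 : ℤ) ^ (γ - u - v') * (-1) ^ (π - 1 - (v : ℤ) - u).toNat *
                (-1) ^ (v' + chainSign (s :: rest) 0) = (-1) ^ (v + (π - 1).toNat + γ + chainSign (s :: rest) 0) := by
              rw [← pow_add, ← pow_add]
              exact neg_one_pow_eq_of_mod_two_eq (by omega)
            rw [← key]; ring
          · simp [plainChoose_eq_zero_of_neg B _ hi]
        · simp [Nat.choose_eq_zero_of_lt (show γ - u < v' by omega)]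
      · simp [Nat.choose_eq_zero_of_lt (show γ < u by omega)]

namespace GenPoint

/-- `ct(p) = (-1)^{chainSign} · ctAbs(p)` unconditionally (depth-5 instance of the chain sign law). -/
theorem ct_eq_sign_mul_ctAbs (p : GenPoint) : p.ct = (-1) ^ chainSign p.chainData 0 * (p.ctAbs : ℤ) :=
  ctChain_eq_sign_mul_posChain p.chainData 0

/-- A passing TOP-pole test forces every pole order `π_j ≥ 1` (the `k` finite facets of TOP). -/
theorem pi_pos_of_topPole (p : GenPoint) (h : p.topPole = true) :
    1 ≤ p.a₀ ∧ 1 ≤ p.b 0 + p.e 1 - 1 ∧ 1 ≤ p.b 1 + p.e 2 - 1 ∧ 1 ≤ p.b 2 + p.e 3 - 1 ∧ 1 ≤ p.b 3 - p.c 4 := by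
  simp [topPole, topPoleTest, chainData, List.range, List.range.loop, Nat.testBit] at h
  omega

/-- **THEOREM R⁺, SIGN LAW — kernel proof** of the node `GenPoint.CtSignLaw` (FAMILY §17n(7)):
`ct(p) = (-1)^{Σ_j(π_j-1) + Σ_{j<4}(c_j-1)} · ctAbs(p)` for admissible `p` passing the TOP-pole test
(admissibility gives `c_j ≥ 1`, the test gives `π_j ≥ 1`, so `signExp p ≥ 0` equals the chain sign exponent). -/
theorem ctSignLaw_holds : CtSignLaw := by
  intro p hp htop
  have hπ := pi_pos_of_topPole p htop
  have h0 := hp 0; have h1 := hp 1; have h2 := hp 2; have h3 := hp 3; have h4 := hp 4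
  simp only [GenPoint.c] at hπ
  have e : chainSign p.chainData 0 = p.signExp.toNat := by
    -- unfold to the ten `toNat`s and remove them one by one (each argument is `≥ 0`), then linear arithmetic
    simp only [chainSign, chainData, signExp, GenPoint.c]
    zify
    rw [Int.toNat_of_nonneg (by omega : (0 : ℤ) ≤ p.a₀ - 1),
      Int.toNat_of_nonneg (by omega : (0 : ℤ) ≤ p.b 0 - p.a 0 - 1),
      Int.toNat_of_nonneg (by omega : (0 : ℤ) ≤ p.b 0 + p.e 1 - 1 - 1),
      Int.toNat_of_nonneg (by omega : (0 : ℤ) ≤ p.b 1 - p.a 1 - 1),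
      Int.toNat_of_nonneg (by omega : (0 : ℤ) ≤ p.b 1 + p.e 2 - 1 - 1),
      Int.toNat_of_nonneg (by omega : (0 : ℤ) ≤ p.b 2 - p.a 2 - 1),
      Int.toNat_of_nonneg (by omega : (0 : ℤ) ≤ p.b 2 + p.e 3 - 1 - 1),
      Int.toNat_of_nonneg (by omega : (0 : ℤ) ≤ p.b 3 - p.a 3 - 1),
      Int.toNat_of_nonneg (by omega : (0 : ℤ) ≤ p.b 3 - (p.b 4 - p.a 4) - 1),
      Int.toNat_of_nonneg (by omega : (0 : ℤ) ≤ p.a₀ - 1 + (p.b 0 + p.e 1 - 2) + (p.b 1 + p.e 2 - 2) +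
        (p.b 2 + p.e 3 - 2) + (p.b 3 - (p.b 4 - p.a 4) - 1) +
        (p.b 0 - p.a 0 - 1 + (p.b 1 - p.a 1 - 1) + (p.b 2 - p.a 2 - 1) + (p.b 3 - p.a 3 - 1)))]
    ring
  rw [ct_eq_sign_mul_ctAbs, e]

end GenPoint

/-! ## The non-vanishing criterion (supply–demand on a path) -/

/-- Last stage: non-zero iff `0 ≤ π - 1 - v ≤ B`. -/
theorem posChain_single_ne_zero_iff (B γ : ℕ) (π : ℤ) (v : ℕ) :
    posChain [(B, γ, π)] v ≠ 0 ↔ 0 ≤ π - 1 - v ∧ π - 1 - v ≤ B := by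
  simp only [posChain]
  exact plainChoose_ne_zero_iff B _

/-- Inner stage (every depth): non-zero iff some split `π - 1 = i + u + v` with `0 ≤ i ≤ B`, `u + v' ≤ γ` continues a
non-zero tail with inherited exponent `v'` (all summands are non-negative; binomials are positive in range). -/
theorem posChain_cons_cons_ne_zero_iff (B γ : ℕ) (π : ℤ) (s : ℕ × ℕ × ℤ) (rest : List (ℕ × ℕ × ℤ)) (v : ℕ) :
    posChain ((B, γ, π) :: s :: rest) v ≠ 0 ↔
      ∃ u v' : ℕ, u + v' ≤ γ ∧ 0 ≤ π - 1 - v - u ∧ π - 1 - v - u ≤ B ∧ posChain (s :: rest) v' ≠ 0 := by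
  rw [posChain_cons_cons]
  constructor
  · intro h
    obtain ⟨u, hu, h1⟩ := Finset.exists_ne_zero_of_sum_ne_zero h
    obtain ⟨v', hv', h2⟩ := Finset.exists_ne_zero_of_sum_ne_zero h1
    rw [Finset.mem_range] at hu hv'
    simp only [ne_eq, mul_eq_zero, not_or] at h2
    obtain ⟨⟨⟨-, -⟩, hpc⟩, hpos⟩ := h2
    rw [← ne_eq, plainChoose_ne_zero_iff] at hpc
    exact ⟨u, v', by omega, hpc.1, hpc.2, hpos⟩
  · rintro ⟨u, v', huv, h0, hB, hpos⟩ h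
    have h1 := (Finset.sum_eq_zero_iff.mp h) u (by rw [Finset.mem_range]; omega)
    have h2 := (Finset.sum_eq_zero_iff.mp h1) v' (by rw [Finset.mem_range]; omega)
    simp only [mul_eq_zero, Nat.choose_eq_zero_iff] at h2
    rcases h2 with ((h2 | h2) | h2) | h2
    · omega
    · omega
    · exact (plainChoose_ne_zero_iff B _).mpr ⟨h0, hB⟩ h2
    · exact hpos h2

/-- **SUPPLY–DEMAND CRITERION at depth 5**: the sign-free constant term of a 5-chain is non-zero iff the TOP-pole test
(`π_j ≥ 1` and the 31 cut conditions `Σ_{j∈S}(π_j-1) ≤ Σ_{j∈S} B_j + Σ_{j∈S ∨ j+1∈S} γ_j`) passes.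
'⟹': a flow satisfies every cut (linear arithmetic). '⟸': the GREEDY flow
`u_j = max(0, π_j-1-v_j-B_j)`, `v_{j+1} = min(γ_j-u_j, π_{j+1}-1)` is feasible — stage `j` uses only the interval cut
conditions `[j,r]` (with the inherited `v_j`), `[j+1,r]`, `[j+2,r]` (max-flow/min-cut on the path network
`B_j → {j}`, `γ_j → {j,j+1}`). -/
theorem posChain_ne_zero_iff_topPoleTest (B₀ γ₀ B₁ γ₁ B₂ γ₂ B₃ γ₃ B₄ γ₄ : ℕ) (π₀ π₁ π₂ π₃ π₄ : ℤ) :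
    posChain [(B₀, γ₀, π₀), (B₁, γ₁, π₁), (B₂, γ₂, π₂), (B₃, γ₃, π₃), (B₄, γ₄, π₄)] 0 ≠ 0 ↔
      topPoleTest [(B₀, γ₀, π₀), (B₁, γ₁, π₁), (B₂, γ₂, π₂), (B₃, γ₃, π₃), (B₄, γ₄, π₄)] = true := by
  simp only [posChain_cons_cons_ne_zero_iff, posChain_single_ne_zero_iff]
  constructor
  · rintro ⟨u0, v1, h01, h02, h03, u1, v2, h11, h12, h13, u2, v3, h21, h22, h23, u3, v4, h31, h32, h33, h41, h42⟩
    simp [topPoleTest, List.range, List.range.loop, Nat.testBit]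
    omega
  · intro h
    simp [topPoleTest, List.range, List.range.loop, Nat.testBit] at h
    obtain ⟨u0, hu0⟩ : ∃ u0 : ℕ, u0 = (π₀ - 1 - B₀).toNat := ⟨_, rfl⟩
    obtain ⟨v1, hv1⟩ : ∃ v1 : ℕ, v1 = min (γ₀ - u0) (π₁ - 1).toNat := ⟨_, rfl⟩
    have s1 : (u0 + v1 ≤ γ₀ ∧ 0 ≤ π₀ - 1 - u0 ∧ π₀ - 1 - u0 ≤ B₀) ∧ (v1 : ℤ) ≤ π₁ - 1 ∧
        π₁ - 1 - v1 ≤ B₁ + γ₁ ∧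
        π₁ - 1 + (π₂ - 1) - v1 ≤ B₁ + B₂ + (γ₁ + γ₂) ∧
        π₁ - 1 + (π₂ - 1) + (π₃ - 1) - v1 ≤ B₁ + B₂ + B₃ + (γ₁ + γ₂ + γ₃) ∧
        π₁ - 1 + (π₂ - 1) + (π₃ - 1) + (π₄ - 1) - v1 ≤ B₁ + B₂ + B₃ + B₄ + (γ₁ + γ₂ + γ₃) := by
      omega
    clear hu0 hv1
    obtain ⟨u1, hu1⟩ : ∃ u1 : ℕ, u1 = (π₁ - 1 - v1 - B₁).toNat := ⟨_, rfl⟩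
    obtain ⟨v2, hv2⟩ : ∃ v2 : ℕ, v2 = min (γ₁ - u1) (π₂ - 1).toNat := ⟨_, rfl⟩
    have s2 : (u1 + v2 ≤ γ₁ ∧ 0 ≤ π₁ - 1 - v1 - u1 ∧ π₁ - 1 - v1 - u1 ≤ B₁) ∧ (v2 : ℤ) ≤ π₂ - 1 ∧
        π₂ - 1 - v2 ≤ B₂ + γ₂ ∧
        π₂ - 1 + (π₃ - 1) - v2 ≤ B₂ + B₃ + (γ₂ + γ₃) ∧
        π₂ - 1 + (π₃ - 1) + (π₄ - 1) - v2 ≤ B₂ + B₃ + B₄ + (γ₂ + γ₃) := by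
      omega
    clear hu1 hv2
    obtain ⟨u2, hu2⟩ : ∃ u2 : ℕ, u2 = (π₂ - 1 - v2 - B₂).toNat := ⟨_, rfl⟩
    obtain ⟨v3, hv3⟩ : ∃ v3 : ℕ, v3 = min (γ₂ - u2) (π₃ - 1).toNat := ⟨_, rfl⟩
    have s3 : (u2 + v3 ≤ γ₂ ∧ 0 ≤ π₂ - 1 - v2 - u2 ∧ π₂ - 1 - v2 - u2 ≤ B₂) ∧ (v3 : ℤ) ≤ π₃ - 1 ∧
        π₃ - 1 - v3 ≤ B₃ + γ₃ ∧
        π₃ - 1 + (π₄ - 1) - v3 ≤ B₃ + B₄ + γ₃ := by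
      omega
    clear hu2 hv3
    obtain ⟨u3, hu3⟩ : ∃ u3 : ℕ, u3 = (π₃ - 1 - v3 - B₃).toNat := ⟨_, rfl⟩
    obtain ⟨v4, hv4⟩ : ∃ v4 : ℕ, v4 = min (γ₃ - u3) (π₄ - 1).toNat := ⟨_, rfl⟩
    have s4 : (u3 + v4 ≤ γ₃ ∧ 0 ≤ π₃ - 1 - v3 - u3 ∧ π₃ - 1 - v3 - u3 ≤ B₃) ∧
        0 ≤ π₄ - 1 - v4 ∧ π₄ - 1 - v4 ≤ B₄ := by
      omega
    clear hu3 hv4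
    exact ⟨u0, v1, by omega, by omega, by omega, u1, v2, by omega, by omega, by omega, u2, v3, by omega, by omega,
      by omega, u3, v4, by omega, by omega, by omega, by omega, by omega⟩

namespace GenPoint

/-- **THEOREM R⁺, NON-VANISHING CRITERION — kernel proof** of the node `GenPoint.CtNeZeroIff` (= the per-`n` TOP-POLE
LAW of FAMILY §17m(1), combinatorial half): `ct(p) ≠ 0 ↔ topPole p` (admissibility is not even needed). -/
theorem ctNeZeroIff_holds : CtNeZeroIff := by
  intro p _
  have hs : ((-1 : ℤ) ^ chainSign p.chainData 0) ≠ 0 := pow_ne_zero _ (by norm_num)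
  have key : p.ctAbs ≠ 0 ↔ p.topPole = true :=
    posChain_ne_zero_iff_topPoleTest _ _ _ _ _ _ _ _ _ _ _ _ _ _ _
  constructor
  · intro h
    refine key.mp fun h0 => h ?_
    rw [ct_eq_sign_mul_ctAbs, h0]; simp
  · intro h
    rw [ct_eq_sign_mul_ctAbs]
    exact mul_ne_zero hs (by exact_mod_cast key.mpr h)

/-- `|ct(p)| = ctAbs(p)`: the TOP coefficient of `ζ(5)` is `±2·ctAbs(p)`, an explicit non-negative count. -/
theorem natAbs_ct (p : GenPoint) : p.ct.natAbs = p.ctAbs := by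
  rw [ct_eq_sign_mul_ctAbs, Int.natAbs_mul, Int.natAbs_pow]; simp

/-- The '`ζ(5)` ABSENT' half of the per-`n` TOP-pole law relative to THEOREM R: if some face of TOP carries no pole
(the test fails) then `J(p) ∈ ℚ + ℚζ(2) + ℚζ(3) + ℚζ(4)`. -/
theorem lowWeight_of_topPole_false (h : TopCoefficientLaw) (p : GenPoint) (hp : p.Admissible) (hi : p.Integrable)
    (ht : p.topPole = false) :
    ∃ q₀ q₂ q₃ q₄ : ℚ, p.J = q₀ + q₂ * (riemannZeta 2).re + q₃ * (riemannZeta 3).re + q₄ * (riemannZeta 4).re := by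
  refine lowWeight_of_ct_eq_zero h p hp hi ?_
  by_contra h0
  have := (ctNeZeroIff_holds p hp).mp h0
  rw [ht] at this
  exact Bool.false_ne_true this

/-- Worked instance (kernel): on the Vasilyev–Zudilin diagonal `n = 2` the law gives `ct = +469 ≠ 0` from the test. -/
theorem ct_zudilin_two_ne_zero : ct ⟨3, fun _ => 3, fun _ => 6, fun _ => 0⟩ ≠ 0 :=
  (ctNeZeroIff_holds _ (by intro j; simp)).mpr (by decide)

end GenPoint

end Summit.KontsevichZagierPeriods.Zeta5Search.SorokinCensus
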